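import Mathlib.RingTheory.MvPolynomial.WeightedHomogeneous
import Mathlib.RingTheory.FiniteType
import Mathlib.RingTheory.RegularLocalRing.Polynomial
import Mathlib.Algebra.Order.Antidiag.Finsupp
import Literature.AlgebraicGeometry.Resolution.AffineBlowupAlgebra
import Literature.AlgebraicGeometry.Resolution.AffineBlowup
import Summits.ResolutionOfSingularities.ResolutionOfSingularities.Theorems.FrobeniusLadderFRationalResolutionVeroneseDegreeSplit
import Summits.ResolutionOfSingularities.ResolutionOfSingularities.Theorems.FrobeniusLadderFRationalResolutionVeroneseMemIff
import Summits.ResolutionOfSingularities.ResolutionOfSingularities.Theorems.FrobeniusLadderFRationalResolutionVeroneseNotRegular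
import HarnessLib

/-!
# Cone programme: the vertex of the Veronese cone `V(n,r)` is a singular point (`n, r ≥ 2`)

Support file for crux stmt-ResolutionOfSingularities-15317 (`FrobeniusLadder.FRationalResolution`), line `redirect`,
lead c5, CONE PROGRAMME (rung 4′ in all dimensions on the Veronese cones `V(n,r) = Spec k[χᵈ : |d| = r]`).
Stub `stub_veronese_vertex_not_regular`: for `n, r ≥ 2` the local ring of the `r`-th Veronese
subring `VR[n,r] = k[χᵈ : |d| = r] ⊆ k[x₁,…,xₙ]` (of Krull dimension `n`) at its vertex `q` — the
prime containing all degree-`r` monomials — is NOT a regular local ring.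

Proof (denominator clearing, no cotangent spaces — the pattern of the toric analogue
`stub_toric_vertex_not_regular` and of `veronese_not_isRegularRing_of_subalgebra`).

* `veroneseSing_mem_vertex_iff` — `t ∈ q ↔ t(0) = 0`: the kernel `𝔪` of evaluation at the origin is
  a maximal ideal of `VR[n,r]`, and `𝔪 ≤ q` because every monomial `χᵈ` occurring in an element of
  `VR[n,r]` has `r ∣ |d|` (`veroneseMemIff_dvd_degree_of_mem`), so for `d ≠ 0` it factors as
  `χᵉ · χ^{d-e}` with `|e| = r` (`Finsupp.exists_le_degree_eq`), `χᵉ ∈ q` and `χ^{d-e} ∈ VR[n,r]`.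
* If `VR[n,r]_q` were regular, then since `dim VR[n,r]_q = ht q ≤ dim VR[n,r] = n` its maximal ideal
  is generated by `≤ n` elements, and after clearing denominators
  (`veronese_not_isRegularRing_exists_finset`) there are `a₁,…,aₘ ∈ q`, `m ≤ n`, such that every
  `g ∈ q` has `u g ∈ (a₁,…,aₘ) VR[n,r]` for some `u ∉ q`.
* Degree-`r` components: elements of `VR[n,r]` have no monomials of degree strictly between `0` and
  `r` (`veroneseSing_coeff_eq_zero`), so `(c y)_r = c(0) • y_r` whenever `y(0) = 0`
  (`veroneseSing_homogeneousComponent_mul`). Hence the degree-`r` component of every `g ∈ q` lies in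
  the `k`-span of `(a₁)_r,…,(aₘ)_r`, a space of dimension `≤ m ≤ n`.
* But the `n + 1` distinct degree-`r` monomials `x₁ʳ,…,xₙʳ, x₁^{r-1} x₂` lie in `q` and equal their
  own degree-`r` components; they are linearly independent (`MvPolynomial.basisMonomials`), so
  `n + 1 ≤ m ≤ n` (`linearIndependent_le_span'`) — contradiction.

[folklore; cf. BrunsHerzog1998, Ex. 2.2.24 (embedding dimension of the Veronese cone is
`#{d : |d| = r} > n`); Matsumura1987, §14] Only Mathlib's `MvPolynomial` / `Algebra.adjoin` /
`IsRegularLocalRing` API and the landed tree files above are used; no named published fact.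
-/

-- single-problem summit: the doubled namespace component is forced
set_option linter.dupNamespace false

noncomputable section

namespace Summit.ResolutionOfSingularities.ResolutionOfSingularities.Theorems.FRationalResolution

open MvPolynomial AlgebraicGeometry
open Literature.AlgebraicGeometry.Resolution

section Cones

variable (k : Type) [Field k]

/-- The polynomial ring in `n` variables. -/
local notation3 "MP[" n "]" => MvPolynomial (Fin n) k

/-- The `r`-th Veronese subring of `k[x₁,…,xₙ]`: the `k`-subalgebra generated by the degree-`r` monomials. -/
local notation3 "VR[" n ", " r "]" =>
  Algebra.adjoin k ((fun d : Fin n →₀ ℕ => MvPolynomial.monomial d (1 : k)) ''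
    {d : Fin n →₀ ℕ | Finsupp.degree d = (r : ℕ)})

/-- **Degree gap.** An element of the Veronese subring `VR[n,r]` has no monomials of total degree
strictly between `0` and `r`: all degrees in its support are divisible by `r`
(`veroneseMemIff_dvd_degree_of_mem`). [folklore] -/
theorem veroneseSing_coeff_eq_zero (n r : ℕ) {c : MP[n]} (hc : c ∈ VR[n, r]) (a : Fin n →₀ ℕ)
    (h0 : 0 < Finsupp.degree a) (hlt : Finsupp.degree a < r) : coeff a c = 0 := by
  by_contra hne
  have hdvd := veroneseMemIff_dvd_degree_of_mem k n r hc a (mem_support_iff.mpr hne)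
  exact absurd (Nat.le_of_dvd h0 hdvd) (not_le.mpr hlt)

/-- **Degree-`r` coefficients of a product across the gap.** If `c` has no monomials of degree
strictly between `0` and `r` and `y` has zero constant term, then for `|d| = r` the coefficient of
`χᵈ` in `c y` is `c(0) y_d`: in `χᵃ χᵇ = χᵈ` with `a ∈ supp c`, `b ∈ supp y` either `a = 0`, or
`0 < |a| < r` (no such `a`), or `|a| = r`, `b = 0` (killed by `y(0) = 0`). [folklore] -/
theorem veroneseSing_coeff_mul {σ : Type*} (r : ℕ) {c y : MvPolynomial σ k}
    (hc : ∀ a : σ →₀ ℕ, 0 < Finsupp.degree a → Finsupp.degree a < r → coeff a c = 0)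
    (hy0 : constantCoeff y = 0) {d : σ →₀ ℕ} (hd : Finsupp.degree d = r) :
    coeff d (c * y) = constantCoeff c * coeff d y := by
  classical
  rw [coeff_mul, show constantCoeff c = coeff 0 c from rfl]
  refine Finset.sum_eq_single (0, d) ?_ ?_
  · rintro ⟨d1, d2⟩ hmem hne
    simp only [Finset.HasAntidiagonal.mem_antidiagonal] at hmem
    have hdeg := congrArg Finsupp.degree hmem
    rw [map_add, hd] at hdeg
    by_cases h0 : d1.degree = 0
    · rw [Finsupp.degree_eq_zero_iff] at h0
      subst h0
      rw [zero_add] at hmem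
      subst hmem
      exact absurd rfl hne
    by_cases hlt : d1.degree < r
    · rw [hc d1 (Nat.pos_of_ne_zero h0) hlt, zero_mul]
    · have h2 : d2.degree = 0 := by omega
      rw [Finsupp.degree_eq_zero_iff] at h2
      subst h2
      rw [show coeff (0 : σ →₀ ℕ) y = constantCoeff y from rfl, hy0, mul_zero]
  · intro h
    exact absurd (Finset.HasAntidiagonal.mem_antidiagonal.mpr (zero_add d)) h

/-- **Degree-`r` component of a product across the gap**: `(c y)_r = c(0) • y_r` when `c` has no
monomials of degree strictly between `0` and `r` and `y(0) = 0` (`veroneseSing_coeff_mul`,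
coefficientwise). [folklore] -/
theorem veroneseSing_homogeneousComponent_mul {σ : Type*} (r : ℕ) {c y : MvPolynomial σ k}
    (hc : ∀ a : σ →₀ ℕ, 0 < Finsupp.degree a → Finsupp.degree a < r → coeff a c = 0)
    (hy0 : constantCoeff y = 0) :
    homogeneousComponent r (c * y) = constantCoeff c • homogeneousComponent r y := by
  ext d
  rw [coeff_homogeneousComponent, coeff_smul, coeff_homogeneousComponent, smul_eq_mul]
  split_ifs with hd
  · exact veroneseSing_coeff_mul k r hc hy0 hd
  · exact (mul_zero _).symm

/-- **Monomials of degree divisible by `r` lie in `VR[n,r]`**: the support of `χᵈ` is `{d}`, so the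
membership criterion `veroneseMemIff_mem_of_dvd_degree` applies, with the degree splitting
`stub_finsupp_degree_split`. [folklore] -/
theorem veroneseSing_monomial_mem (n r : ℕ) (d : Fin n →₀ ℕ) (hd : r ∣ Finsupp.degree d) :
    (monomial d (1 : k) : MP[n]) ∈ VR[n, r] := by
  classical
  refine veroneseMemIff_mem_of_dvd_degree k n r
    (fun s e he => stub_finsupp_degree_split r s e he) ?_
  intro d' hd'
  rw [Finset.mem_singleton.mp (support_monomial_subset hd')]
  exact hd

/-- **The vertex is the kernel of evaluation at the origin.** For `1 ≤ r`, if a prime `q` of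
`VR[n,r]` contains every degree-`r` monomial, then `t ∈ q ↔ t(0) = 0`. Indeed the kernel `𝔪` of
`t ↦ t(0)` (a surjection onto `k`) is maximal, and `𝔪 ≤ q`: an element `t` with `t(0) = 0` is the
`k`-combination `∑ t_d χᵈ` over its support (`MvPolynomial.as_sum`), where each `d ≠ 0` has
`r ∣ |d|` (`veroneseMemIff_dvd_degree_of_mem`), hence `d = e + d'` with `|e| = r`
(`Finsupp.exists_le_degree_eq`) and `χᵈ = χᵉ χ^{d'}` with `χᵉ ∈ q`, `χ^{d'} ∈ VR[n,r]`
(`veroneseSing_monomial_mem`); so `𝔪 = q` by maximality (`Ideal.IsMaximal.eq_of_le`). [folklore] -/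
theorem veroneseSing_mem_vertex_iff (n r : ℕ) (hr : 1 ≤ r) (q : PrimeSpectrum ↥VR[n, r])
    (hq : ∀ v : ↥VR[n, r], (∃ d : Fin n →₀ ℕ, Finsupp.degree d = r ∧
      (v : MP[n]) = MvPolynomial.monomial d 1) → v ∈ q.asIdeal) (t : ↥VR[n, r]) :
    t ∈ q.asIdeal ↔ constantCoeff (t : MP[n]) = 0 := by
  classical
  have _ := hr
  obtain ⟨ψ, hψ⟩ : ∃ ψ : ↥VR[n, r] →+* k, ∀ y : ↥VR[n, r], ψ y = constantCoeff (y : MP[n]) :=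
    ⟨constantCoeff.comp (VR[n, r]).val.toRingHom, fun y => rfl⟩
  have hψs : Function.Surjective ψ := fun c => ⟨algebraMap k (↥VR[n, r]) c, by rw [hψ]; simp⟩
  have hmax : (RingHom.ker ψ).IsMaximal := RingHom.ker_isMaximal_of_surjective ψ hψs
  -- the image `Q ⊆ k[x₁,…,xₙ]` of `q`, a `k`-subspace
  set Q : Submodule k MP[n] := (q.asIdeal.restrictScalars k).map (VR[n, r]).val.toLinearMap with hQ
  have hQ_of : ∀ y : ↥VR[n, r], y ∈ q.asIdeal → (y : MP[n]) ∈ Q := fun y hy =>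
    Submodule.mem_map_of_mem (f := (VR[n, r]).val.toLinearMap) hy
  have hQ_to : ∀ y : ↥VR[n, r], (y : MP[n]) ∈ Q → y ∈ q.asIdeal := by
    intro y hy
    obtain ⟨y', hy', hyy⟩ := Submodule.mem_map.mp hy
    rw [← Subtype.val_injective hyy]
    exact hy'
  -- every monomial `χᵈ` with `r ∣ |d|`, `d ≠ 0`, lies in `Q`
  have hmon : ∀ d : Fin n →₀ ℕ, r ∣ Finsupp.degree d → d ≠ 0 →
      (monomial d (1 : k) : MP[n]) ∈ Q := by
    intro d hdvd hd0
    have hrle : r ≤ Finsupp.degree d := by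
      refine Nat.le_of_dvd (Nat.pos_of_ne_zero ?_) hdvd
      rwa [Ne, Finsupp.degree_eq_zero_iff]
    obtain ⟨e, hed, hdeg⟩ := Finsupp.exists_le_degree_eq d r hrle
    obtain ⟨d', rfl⟩ := le_iff_exists_add.mp hed
    have hd' : r ∣ Finsupp.degree d' := by
      rw [map_add, hdeg] at hdvd
      exact (Nat.dvd_add_right (dvd_refl r)).mp hdvd
    have hye : (⟨monomial e (1 : k), Algebra.subset_adjoin ⟨e, hdeg, rfl⟩⟩ : ↥VR[n, r]) ∈
        q.asIdeal := hq _ ⟨e, hdeg, rfl⟩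
    have h := hQ_of _ (Ideal.mul_mem_right
      (⟨monomial d' (1 : k), veroneseSing_monomial_mem k n r d' hd'⟩ : ↥VR[n, r]) _ hye)
    simpa only [Subalgebra.coe_mul, monomial_mul, mul_one] using h
  -- hence `𝔪 ≤ q`
  have hker : ∀ y : ↥VR[n, r], constantCoeff (y : MP[n]) = 0 → y ∈ q.asIdeal := by
    intro y hy
    apply hQ_to
    rw [(y : MP[n]).as_sum]
    refine Submodule.sum_mem _ fun d hd => ?_
    have hd0 : d ≠ 0 := by
      rintro rfl
      have hy' : coeff 0 (y : MP[n]) = 0 := hy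
      exact (mem_support_iff.mp hd) hy'
    have hmem := hmon d (veroneseMemIff_dvd_degree_of_mem k n r y.2 d hd) hd0
    have hsm : (monomial d (coeff d (y : MP[n])) : MP[n]) =
        coeff d (y : MP[n]) • (monomial d (1 : k) : MP[n]) := by
      rw [smul_monomial, smul_eq_mul, mul_one]
    rw [hsm]
    exact Submodule.smul_mem _ _ hmem
  have hle : RingHom.ker ψ ≤ q.asIdeal := fun y hy =>
    hker y (by rwa [RingHom.mem_ker, hψ] at hy)
  have heq : RingHom.ker ψ = q.asIdeal := hmax.eq_of_le q.isPrime.ne_top hle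
  rw [← heq, RingHom.mem_ker, hψ]

/-- **THE VERTEX OF THE VERONESE CONE `V(n,r)` IS SINGULAR FOR `n, r ≥ 2`** (registered stub
`stub_veronese_vertex_not_regular`, crux stmt-ResolutionOfSingularities-15317, line `redirect`). For
the Veronese subring `VR[n,r] = k[χᵈ : |d| = r] ⊆ k[x₁,…,xₙ]` of Krull dimension `n` and `q` its
vertex (the prime containing all degree-`r` monomials; `t ∈ q ↔ t(0) = 0`,
`veroneseSing_mem_vertex_iff`), the local ring `VR[n,r]_q` is not regular: otherwise `q VR[n,r]_q`
has `≤ ht q ≤ n` generators, denominators clear to `a₁,…,aₘ ∈ q`, `m ≤ n`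
(`veronese_not_isRegularRing_exists_finset`), and taking degree-`r` components
(`veroneseSing_homogeneousComponent_mul`: `(c y)_r = c(0) • y_r` for `y(0) = 0`) puts the `n + 1`
linearly independent monomials `x₁ʳ,…,xₙʳ, x₁^{r-1} x₂ ∈ q` in the span of `(a₁)_r,…,(aₘ)_r`:
`n + 1 ≤ m ≤ n`. (Embedding dimension of the vertex `= #{d : |d| = r} = C(n+r-1, r) > n`.)
[folklore; cf. BrunsHerzog1998, Ex. 2.2.24; Matsumura1987, §14] -/
theorem stub_veronese_vertex_not_regular (n r : ℕ) (hn : 2 ≤ n) (hr : 2 ≤ r)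
    (hdim : ringKrullDim ↥VR[n, r] = n) (q : PrimeSpectrum ↥VR[n, r])
    (hq : ∀ v : ↥VR[n, r], (∃ d : Fin n →₀ ℕ, Finsupp.degree d = r ∧
      (v : MP[n]) = MvPolynomial.monomial d 1) → v ∈ q.asIdeal) :
    ¬ IsRegularLocalRing (Localization.AtPrime q.asIdeal) := by
  classical
  intro hreg
  have hr1 : 1 ≤ r := by omega
  -- membership in the vertex is vanishing of the constant coefficient
  have hmem : ∀ t : ↥VR[n, r], t ∈ q.asIdeal ↔ constantCoeff (t : MP[n]) = 0 :=
    veroneseSing_mem_vertex_iff k n r hr1 q hq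
  -- `VR[n,r]_q` is regular local of dimension `ht q ≤ dim VR[n,r] = n`: `≤ n` generators
  have hgen : (IsLocalRing.maximalIdeal (Localization.AtPrime q.asIdeal)).spanFinrank ≤ n := by
    have h := hreg.spanFinrank_maximalIdeal.trans_le
      ((IsLocalization.AtPrime.ringKrullDim_eq_height q.asIdeal
        (Localization.AtPrime q.asIdeal)).trans_le
        (Ideal.height_le_ringKrullDim_of_isPrime.trans hdim.le))
    exact_mod_cast h
  haveI : IsNoetherianRing (Localization.AtPrime q.asIdeal) := hreg.toIsNoetherian
  obtain ⟨s, hscard, hsm, hsgen⟩ := veronese_not_isRegularRing_exists_finset q.asIdeal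
    (IsNoetherian.noetherian _) hgen
  -- the degree-`r` component `f` of an element of `VR[n,r]`
  set f : ↥VR[n, r] → MP[n] := fun y => homogeneousComponent r (y : MP[n]) with hf
  have hgap : ∀ c : ↥VR[n, r], ∀ a : Fin n →₀ ℕ, 0 < Finsupp.degree a → Finsupp.degree a < r →
      coeff a (c : MP[n]) = 0 := fun c a h0 hlt => veroneseSing_coeff_eq_zero k n r c.2 a h0 hlt
  have hf_add : ∀ y z : ↥VR[n, r], f (y + z) = f y + f z := by
    intro y z
    simp only [hf, Subalgebra.coe_add, map_add]
  have hf_mul : ∀ c y : ↥VR[n, r], constantCoeff (y : MP[n]) = 0 →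
      f (c * y) = constantCoeff (c : MP[n]) • f y := by
    intro c y hy0
    simp only [hf, Subalgebra.coe_mul]
    exact veroneseSing_homogeneousComponent_mul k r (hgap c) hy0
  -- the degree-`r` components of elements of `q` lie in the span `V` of those of `s` ...
  have hV : ∀ g : ↥VR[n, r], g ∈ q.asIdeal →
      f g ∈ Submodule.span k (↑(s.image f) : Set MP[n]) := by
    intro g hg
    obtain ⟨u, hu, hug⟩ := hsgen g hg
    have hu0 : constantCoeff (u : MP[n]) ≠ 0 := fun h => hu ((hmem u).mpr h)
    have key : u * g ∈ q.asIdeal ∧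
        f (u * g) ∈ Submodule.span k (↑(s.image f) : Set MP[n]) := by
      refine Submodule.span_induction
        (p := fun y _ => y ∈ q.asIdeal ∧
          f y ∈ Submodule.span k (↑(s.image f) : Set MP[n])) ?_ ?_ ?_ ?_ hug
      · intro z hz
        exact ⟨hsm z hz, Submodule.subset_span
          (Finset.mem_coe.mpr (Finset.mem_image_of_mem f (Finset.mem_coe.mp hz)))⟩
      · refine ⟨Ideal.zero_mem _, ?_⟩
        have h0 : f 0 = 0 := by
          simp only [hf, ZeroMemClass.coe_zero, map_zero]
        rw [h0]
        exact Submodule.zero_mem _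
      · rintro y z - - ⟨hyq, hy⟩ ⟨hzq, hz⟩
        refine ⟨Ideal.add_mem _ hyq hzq, ?_⟩
        rw [hf_add]
        exact Submodule.add_mem _ hy hz
      · rintro c y - ⟨hyq, hy⟩
        refine ⟨Ideal.mul_mem_left _ c hyq, ?_⟩
        rw [smul_eq_mul, hf_mul c y ((hmem y).mp hyq)]
        exact Submodule.smul_mem _ _ hy
    have h := key.2
    rw [hf_mul u g ((hmem g).mp hg)] at h
    exact (Submodule.smul_mem_iff _ hu0).mp h
  -- ... which contains `χᵈ` for every exponent `d` of degree `r`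
  have hin : ∀ d : Fin n →₀ ℕ, Finsupp.degree d = r →
      (monomial d (1 : k) : MP[n]) ∈
        (Submodule.span k (↑(s.image f) : Set MP[n]) : Set MP[n]) := by
    intro d hd
    have hy : (⟨monomial d (1 : k), Algebra.subset_adjoin ⟨d, hd, rfl⟩⟩ : ↥VR[n, r]) ∈
        q.asIdeal := hq _ ⟨d, hd, rfl⟩
    have h := hV _ hy
    simp only [hf, homogeneousComponent_eq_self (isHomogeneous_monomial (1 : k) hd)] at h
    exact h
  -- `n + 1` distinct exponents of degree `r`: `(r-1) e₁ + e₂` and `r eᵢ`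
  set i₀ : Fin n := ⟨0, by omega⟩ with hi₀
  set i₁ : Fin n := ⟨1, by omega⟩ with hi₁
  have h01 : i₀ ≠ i₁ := by
    simp only [hi₀, hi₁, Ne, Fin.mk.injEq]
    omega
  set e : Fin (n + 1) → (Fin n →₀ ℕ) :=
    Fin.cons (Finsupp.single i₀ (r - 1) + Finsupp.single i₁ 1) (fun i => Finsupp.single i r)
    with he
  have he_deg : ∀ i, Finsupp.degree (e i) = r := by
    refine Fin.cases ?_ (fun i => ?_)
    · simp only [he, Fin.cons_zero, map_add, Finsupp.degree_single]
      omega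
    · simp only [he, Fin.cons_succ, Finsupp.degree_single]
  have he_inj : Function.Injective e := by
    refine Fin.cons_injective_iff.mpr ⟨?_, Finsupp.single_left_injective (by omega)⟩
    rintro ⟨i, hi⟩
    have h := DFunLike.congr_fun hi i₁
    simp only [Finsupp.add_apply, Finsupp.single_apply, if_neg h01, zero_add] at h
    split_ifs at h
    omega
  have hli : LinearIndependent k (fun i => (monomial (e i) (1 : k) : MP[n])) :=
    (basisMonomials (Fin n) k).linearIndependent.comp e he_inj
  have hrange : Set.range (fun i => (monomial (e i) (1 : k) : MP[n])) ⊆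
      (Submodule.span k (↑(s.image f) : Set MP[n]) : Set MP[n]) := by
    rintro _ ⟨i, rfl⟩
    exact hin (e i) (he_deg i)
  have h3 : Cardinal.mk (Fin (n + 1)) ≤ (s.image f).card := by
    simpa only [Finset.coe_sort_coe, Fintype.card_coe] using
      linearIndependent_le_span' _ hli _ hrange
  have h3' : n + 1 ≤ (s.image f).card := by
    rw [Cardinal.mk_fintype, Fintype.card_fin] at h3
    exact_mod_cast h3
  have h2 : (s.image f).card ≤ n := Finset.card_image_le.trans hscard
  omega

end Cones

end Summit.ResolutionOfSingularities.ResolutionOfSingularities.Theorems.FRationalResolution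

end
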